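import Literature.Topology.CoveringSpaces.CoveringGaloisCorrespondenceEquivalence
import Literature.AnabelianGeometry.AbsoluteAnabelian.FiniteGSetsIdRigid
import HarnessLib

/-!
# Slices of the category of finite covering spaces are id-rigid when `π̂₁` is slim

PROOF-ONLY companion (abc-iut cell, campaign-L R1 STEP 3 (3γ), GAP row G-L4t14-R1 support; seat
abc-iut-f-072).  [AbsTopIII] Prop. 4.2 (i) p. 106 l. 14–19 reads the id-rigidity of the geometric `EA`
through the full subcategory of «objects mapping to `𝕏`», identified with `Loc(𝕏)`, id-rigid «by the
slimness of `Π_𝕏`» (Lemma 4.3); [AbsTopIII] §0 p. 27: slim ⟹ every slice is id-rigid.  At the TOPOLOGICAL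
level, for `X` path connected and strongly locally contractible with basepoint `x₀`:

* `CovFin.isIdRigid_over_of_isSlim_bCat` — every slice `Cov^fin(X)_{/E}` is id-rigid when `B(π̂₁(X,x₀))`
  is slim (universe-polymorphic);
* `CovFin.isIdRigid_over` — the same from `IsSlimGroup (π̂₁(X, x₀))` (`X : Type`, the universe at which
  the tree's named fact `bCat_isSlim_iff_isSlimGroup` is stated);
* `CovFin.isIdRigid_iff_center_eq_bot` — `Cov^fin(X)` itself is id-rigid IFF `Z(π̂₁(X, x₀)) = 1`.

Transport of `Literature.AnabelianGeometry.AbsoluteAnabelian.isIdRigid_over_action_fintypeCat_*` /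
`isIdRigid_action_fintypeCat_iff_center_eq_bot` along abc-iut-w5-d144's finite Galois correspondence
`CovFin.galoisCorrespondence x₀ : CovFin X ≌ Action FintypeCat (π₁(X, x₀))` (Hatcher Thm. 1.38).
No definition, no named fact; nothing here bears on [IUTchIII] Cor. 3.12.
-/

noncomputable section

open CategoryTheory

universe u

namespace Literature.Topology.CoveringSpaces.CovFin

open Literature.AnabelianGeometry.AbsoluteAnabelian Literature.AlgebraicGeometry.Frobenioids
open Literature.IUT.HodgeTheaters

/-- **Every slice of `Cov^fin(X)` is id-rigid when `B(π̂₁(X, x₀))` is slim** (universe-polymorphic form).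
[cite: MochizukiAbsTopIII2015, Section 0 p.27] -/
theorem isIdRigid_over_of_isSlim_bCat {X : Type u} [TopologicalSpace X] [PathConnectedSpace X]
    [StronglyLocallyContractibleSpace X] (x₀ : X)
    (h : IsSlim (BCat (profiniteCompletion (FundamentalGroup X x₀)))) (E : CovFin X) :
    IsIdRigid (Over E) :=
  isIdRigid_over_of_equivalence (galoisCorrespondence (X := X) x₀) E
    (isIdRigid_over_action_fintypeCat_of_isSlim_bCat _ h _)

/-- **Every slice of `Cov^fin(X)` is id-rigid when the profinite completion `π̂₁(X, x₀)` is slim** — the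
topological form of [AbsTopIII] Prop. 4.2 (i)'s «objects mapping to `𝕏` … id-rigid by the slimness of
`Π_𝕏`» (Lemma 4.3), read over `Cov^fin`. [cite: MochizukiAbsTopIII2015, Prop. 4.2 (i) p.106] -/
theorem isIdRigid_over {X : Type} [TopologicalSpace X] [PathConnectedSpace X]
    [StronglyLocallyContractibleSpace X] (x₀ : X)
    (h : IsSlimGroup (profiniteCompletion (FundamentalGroup X x₀))) (E : CovFin X) :
    IsIdRigid (Over E) :=
  isIdRigid_over_of_equivalence (galoisCorrespondence (X := X) x₀) E
    (isIdRigid_over_action_fintypeCat_of_isSlimGroup _ h _)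

/-- **`Cov^fin(X)` is id-rigid IFF `π̂₁(X, x₀)` is centre-free.** [cite: MochizukiSemiAnbd2006, Section 0 p.6] -/
theorem isIdRigid_iff_center_eq_bot {X : Type u} [TopologicalSpace X] [PathConnectedSpace X]
    [StronglyLocallyContractibleSpace X] (x₀ : X) :
    IsIdRigid (CovFin X) ↔ Subgroup.center (profiniteCompletion (FundamentalGroup X x₀)) = ⊥ := by
  rw [← isIdRigid_action_fintypeCat_iff_center_eq_bot]
  exact ⟨fun h => isIdRigid_of_equivalence' (galoisCorrespondence (X := X) x₀) h,
    fun h => isIdRigid_of_equivalence (galoisCorrespondence (X := X) x₀) h⟩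

end Literature.Topology.CoveringSpaces.CovFin
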